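import Literature.NumberTheory.LFunctions.ClassGroupUnsmoothing
import Literature.NumberTheory.LFunctions.ClassGroupExplicitFormula
import HarnessLib

/-!
# Weighted Chebyshev functions of a number field: `ψ_w`, the smoothed `ψ̃_w`, and the smoothing sandwich

Topic `Summits/QuantumAdvantage/QuantumAdvantage/Theorems`, cell B2b-1 (linnik-cubic), PART A (gen 12);
helper toward the crux `DegreeOnePrimesEscape` (stmt-QuantumAdvantage-11543) of route `LinnikCubicClassGroups`
— the unsmoothing step of the Lagarias–Montgomery–Odlyzko theorem for conjugacy classes inside a division
(LMO-PLAN M5).  HONEST FRAMING: the value of this file is a THEOREM (kernel-checked lemmas) — NOT summit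
progress.

The tree's `ClassGroupSmoothedPsi` / `ClassGroupUnsmoothing` treat the weight `𝟙_C` of an ideal class; the
Deuring reduction needs the weight "`𝔫 = 𝔭^k` with `𝔭` unramified in `N` and `Frob_𝔭^k = σ`".  This file redoes
the purely combinatorial part for an ARBITRARY weight `w : Ideal (𝓞 K) → ℝ` with `0 ≤ w ≤ 1`:

* `(∑ I ∈ idealsOfNorm K n, w I * idealVonMangoldt I) = Σ_{𝔑𝔫 = n} w(𝔫) Λ(𝔫)`, `(∑ n ∈ Icc 0 ⌊x⌋₊, ∑ I ∈ idealsOfNorm K n, w I * idealVonMangoldt I) = Σ_{n ≤ x} Λ_w(n)`,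
  `(∑' n : ℕ, (∑ I ∈ idealsOfNorm K n, w I * idealVonMangoldt I) * g (Real.log n)) = Σ_n Λ_w(n) g(log n)`;
* `0 ≤ Λ_w(n) ≤ Λ_K(n)`, `ψ_w` monotone, `ψ_w(y) − ψ_w(x) ≤ ψ_K(y) − ψ_K(x)`, `ψ_w ≤ ψ_K`;
* the sandwich for the Thorner–Zaman weight `g_x = tzTest (log x) ε`:
  `ψ̃_w(g_x) ≤ ψ_w(x e^ε)` and `ψ_w(x) ≤ ψ̃_w(g_x) + ψ_w(√x)`;
* `coefFordK (Λ_w) g 0 = ψ̃_w(g)` (the smoothed sum is the value at `0` of the tree's `K_{g,Λ_w}`).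
References: [ThornerZaman2019, §2.4, §5 (5.3)].
-/

noncomputable section

open Finset Real
open scoped NumberField nonZeroDivisors

namespace Summit.QuantumAdvantage.QuantumAdvantage.Theorems.DegreeOnePrimesEscape

open Literature.NumberTheory.LFunctions Literature.NumberTheory.LFunctions.NumberField
  Literature.NumberTheory.LFunctions.TZWeight

variable {K : Type} [Field K] [NumberField K]

/-! ### The weighted von Mangoldt function and `ψ_w` -/

variable {w : Ideal (𝓞 K) → ℝ}

/-- `0 ≤ Λ_w(n)` for `w ≥ 0`. -/
theorem vonMangoldtWeighted_nonneg (hw : ∀ I, 0 ≤ w I) (n : ℕ) : 0 ≤ (∑ I ∈ idealsOfNorm K n, w I * idealVonMangoldt I) :=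
  sum_nonneg fun I _ ↦ mul_nonneg (hw I) (idealVonMangoldt_nonneg I)

/-- `Λ_w(n) ≤ Λ_K(n)` (norm-indexed `vonMangoldtNorm`) for `w ≤ 1`. -/
theorem vonMangoldtWeighted_le (hw1 : ∀ I, w I ≤ 1) (n : ℕ) : (∑ I ∈ idealsOfNorm K n, w I * idealVonMangoldt I) ≤ vonMangoldtNorm K n := by
  unfold vonMangoldtNorm
  refine sum_le_sum fun I _ ↦ ?_
  have := idealVonMangoldt_nonneg I
  nlinarith [hw1 I]

/-- `Λ_w(0) = 0`. -/
theorem vonMangoldtWeighted_zero (w : Ideal (𝓞 K) → ℝ) : (∑ I ∈ idealsOfNorm K 0, w I * idealVonMangoldt I) = 0 := by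
  rw [idealsOfNorm_zero, sum_singleton, idealVonMangoldt_bot, mul_zero]

/-- `0 ≤ ψ_w(x)`. -/
theorem psiWeighted_nonneg (hw : ∀ I, 0 ≤ w I) (x : ℝ) : 0 ≤ (∑ n ∈ Icc 0 ⌊x⌋₊, ∑ I ∈ idealsOfNorm K n, w I * idealVonMangoldt I) :=
  sum_nonneg fun n _ ↦ vonMangoldtWeighted_nonneg hw n

/-- `ψ_w` is monotone. -/
theorem psiWeighted_mono (hw : ∀ I, 0 ≤ w I) {x y : ℝ} (hxy : x ≤ y) :
    (∑ n ∈ Icc 0 ⌊x⌋₊, ∑ I ∈ idealsOfNorm K n, w I * idealVonMangoldt I) ≤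
      ∑ n ∈ Icc 0 ⌊y⌋₊, ∑ I ∈ idealsOfNorm K n, w I * idealVonMangoldt I := by
  exact sum_le_sum_of_subset_of_nonneg (Icc_subset_Icc le_rfl (Nat.floor_le_floor hxy))
    fun n _ _ ↦ vonMangoldtWeighted_nonneg hw n

/-- `ψ_w(x) ≤ ψ_K(x)` for `0 ≤ w ≤ 1`. -/
theorem psiWeighted_le_chebyshevPsiIdeal (hw1 : ∀ I, w I ≤ 1) (x : ℝ) :
    (∑ n ∈ Icc 0 ⌊x⌋₊, ∑ I ∈ idealsOfNorm K n, w I * idealVonMangoldt I) ≤ chebyshevPsiIdeal K x := by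
  rw [chebyshevPsiIdeal_eq_sum_vonMangoldtNorm]
  exact sum_le_sum fun n _ ↦ vonMangoldtWeighted_le hw1 n

/-- **Short intervals**: `ψ_w(y) − ψ_w(x) ≤ ψ_K(y) − ψ_K(x)` for `x ≤ y`. -/
theorem psiWeighted_sub_le (hw1 : ∀ I, w I ≤ 1) {x y : ℝ} (hxy : x ≤ y) :
    (∑ n ∈ Icc 0 ⌊y⌋₊, ∑ I ∈ idealsOfNorm K n, w I * idealVonMangoldt I) - (∑ n ∈ Icc 0 ⌊x⌋₊, ∑ I ∈ idealsOfNorm K n, w I * idealVonMangoldt I) ≤ chebyshevPsiIdeal K y - chebyshevPsiIdeal K x := by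
  have hsub : Icc 0 ⌊x⌋₊ ⊆ Icc 0 ⌊y⌋₊ := Icc_subset_Icc le_rfl (Nat.floor_le_floor hxy)
  rw [chebyshevPsiIdeal_eq_sum_vonMangoldtNorm, chebyshevPsiIdeal_eq_sum_vonMangoldtNorm,
    ← sum_sdiff hsub, ← sum_sdiff hsub, add_sub_cancel_right, add_sub_cancel_right]
  exact sum_le_sum fun n _ ↦ vonMangoldtWeighted_le hw1 n

/-! ### The smoothed sum -/

/-- `ψ̃_w(g)` as a finite sum when `g = 0` on `[x₀, ∞)` and `x₀ ≤ log N`. -/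
theorem smoothedPsiWeighted_eq_sum (w : Ideal (𝓞 K) → ℝ) {g : ℝ → ℝ} {x₀ : ℝ} (hg : ∀ u, x₀ ≤ u → g u = 0)
    {N : ℕ} (hN : 1 ≤ N) (hx : x₀ ≤ Real.log N) :
    (∑' n : ℕ, (∑ I ∈ idealsOfNorm K n, w I * idealVonMangoldt I) * g (Real.log n)) = ∑ n ∈ Finset.range N, (∑ I ∈ idealsOfNorm K n, w I * idealVonMangoldt I) * g (Real.log n) := by
  rw [tsum_eq_sum]
  intro n hn
  rw [Finset.mem_range, not_lt] at hn
  have hlog : x₀ ≤ Real.log n := hx.trans (Real.log_le_log (by exact_mod_cast hN) (by exact_mod_cast hn))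
  simp [hg _ hlog]

/-- `ψ̃_w(g) ≥ 0` for `g ≥ 0`, `w ≥ 0`. -/
theorem smoothedPsiWeighted_nonneg (hw : ∀ I, 0 ≤ w I) {g : ℝ → ℝ} (hg : ∀ u, 0 ≤ g u) :
    0 ≤ (∑' n : ℕ, (∑ I ∈ idealsOfNorm K n, w I * idealVonMangoldt I) * g (Real.log n)) :=
  tsum_nonneg fun n ↦ mul_nonneg (vonMangoldtWeighted_nonneg hw n) (hg _)

/-- **`K_{g, Λ_w}(0) = ψ̃_w(g)`**: the value at `s = 0` of the tree's smoothed Dirichlet series with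
coefficients `Λ_w` is the smoothed weighted sum. -/
theorem coefFordK_vonMangoldtWeighted_zero (w : Ideal (𝓞 K) → ℝ) (g : ℝ → ℝ) :
    coefFordK (fun n ↦ ((∑ I ∈ idealsOfNorm K n, w I * idealVonMangoldt I : ℝ) : ℂ)) g 0 =
      ((∑' n : ℕ, (∑ I ∈ idealsOfNorm K n, w I * idealVonMangoldt I) * g (Real.log n) : ℝ) : ℂ) := by
  rw [coefFordK, Complex.ofReal_tsum]
  refine tsum_congr fun n ↦ ?_
  rw [neg_zero, Complex.cpow_zero, mul_one, Complex.ofReal_mul]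

/-! ### The smoothing sandwich for the Thorner–Zaman weight -/

/-- **`ψ̃_w(g_x) ≤ ψ_w(x e^{ε})`** for `g_x = tzTest (log x) ε`. [cite: ThornerZaman2019, §2.4 Lemma 2.3] -/
theorem smoothedPsiWeighted_le_psiWeighted (hw : ∀ I, 0 ≤ w I) {x ε : ℝ} (hx : 1 < x) (hε : 0 < ε) :
    (∑' n : ℕ, (∑ I ∈ idealsOfNorm K n, w I * idealVonMangoldt I) * tzTest (Real.log x) ε (Real.log n)) ≤ (∑ n ∈ Icc 0 ⌊x * Real.exp ε⌋₊, ∑ I ∈ idealsOfNorm K n, w I * idealVonMangoldt I) := by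
  have hL : 0 < Real.log x := Real.log_pos hx
  have hx0 : 0 < x := by linarith
  set N : ℕ := ⌊x * Real.exp ε⌋₊ + 1 with hN
  have hN1 : 1 ≤ N := by omega
  have hxe : 0 < x * Real.exp ε := by positivity
  have hNlog : Real.log x + ε ≤ Real.log N := by
    have h1 : x * Real.exp ε ≤ N := by rw [hN]; push_cast; exact (Nat.lt_floor_add_one _).le
    have := Real.log_le_log hxe h1
    rwa [Real.log_mul hx0.ne' (Real.exp_pos ε).ne', Real.log_exp] at this
  rw [smoothedPsiWeighted_eq_sum w (fun u hu ↦ tzTest_eq_zero_of_ge hL hε hu) hN1 hNlog]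
  have hrange : Finset.range N = Icc 0 ⌊x * Real.exp ε⌋₊ := by
    ext n; rw [Finset.mem_range, mem_Icc, hN]; omega
  rw [hrange]
  refine Finset.sum_le_sum fun n _ ↦ ?_
  have h01 := tzTest_mem_Icc (Real.log x) ε (Real.log n)
  have h0 := vonMangoldtWeighted_nonneg (K := K) hw n
  nlinarith [h01.2]

/-- **`ψ_w(x) ≤ ψ̃_w(g_x) + ψ_w(√x)`** (`g_x(log n) = 1` for `√x ≤ n ≤ x`). [cite: ThornerZaman2019, §2.4 Lemma 2.3] -/
theorem psiWeighted_le_smoothedPsiWeighted_add (hw : ∀ I, 0 ≤ w I) {x ε : ℝ} (hx : 1 < x) (hε : 0 < ε) :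
    (∑ n ∈ Icc 0 ⌊x⌋₊, ∑ I ∈ idealsOfNorm K n, w I * idealVonMangoldt I) ≤ (∑' n : ℕ, (∑ I ∈ idealsOfNorm K n, w I * idealVonMangoldt I) * tzTest (Real.log x) ε (Real.log n)) + (∑ n ∈ Icc 0 ⌊Real.sqrt x⌋₊, ∑ I ∈ idealsOfNorm K n, w I * idealVonMangoldt I) := by
  have hL : 0 < Real.log x := Real.log_pos hx
  have hx0 : 0 < x := by linarith
  set N : ℕ := ⌊x * Real.exp ε⌋₊ + 1 with hN
  have hN1 : 1 ≤ N := by omega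
  have hxe : 0 < x * Real.exp ε := by positivity
  have hNlog : Real.log x + ε ≤ Real.log N := by
    have h1 : x * Real.exp ε ≤ N := by rw [hN]; push_cast; exact (Nat.lt_floor_add_one _).le
    have := Real.log_le_log hxe h1
    rwa [Real.log_mul hx0.ne' (Real.exp_pos ε).ne', Real.log_exp] at this
  rw [smoothedPsiWeighted_eq_sum w (fun u hu ↦ tzTest_eq_zero_of_ge hL hε hu) hN1 hNlog]
  have hsx : ⌊Real.sqrt x⌋₊ ≤ ⌊x⌋₊ := Nat.floor_le_floor (by
    rw [Real.sqrt_le_left hx0.le]; nlinarith)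
  have hsplit : Icc 0 ⌊x⌋₊ = Icc 0 ⌊Real.sqrt x⌋₊ ∪ Finset.Ioc ⌊Real.sqrt x⌋₊ ⌊x⌋₊ := by
    ext n; simp only [mem_Icc, Finset.mem_union, Finset.mem_Ioc]; omega
  have hdisj : Disjoint (Icc 0 ⌊Real.sqrt x⌋₊) (Finset.Ioc ⌊Real.sqrt x⌋₊ ⌊x⌋₊) := by
    rw [Finset.disjoint_left]; intro n h1 h2; rw [mem_Icc] at h1; rw [Finset.mem_Ioc] at h2; omega
  rw [hsplit, Finset.sum_union hdisj, add_comm]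
  refine add_le_add ?_ le_rfl
  have hsub : Finset.Ioc ⌊Real.sqrt x⌋₊ ⌊x⌋₊ ⊆ Finset.range N := by
    intro n hn
    rw [Finset.mem_Ioc] at hn; rw [Finset.mem_range, hN]
    have : ⌊x⌋₊ ≤ ⌊x * Real.exp ε⌋₊ := Nat.floor_le_floor (by
      have := Real.one_le_exp hε.le; nlinarith)
    omega
  calc ∑ n ∈ Finset.Ioc ⌊Real.sqrt x⌋₊ ⌊x⌋₊, (∑ I ∈ idealsOfNorm K n, w I * idealVonMangoldt I)
      = ∑ n ∈ Finset.Ioc ⌊Real.sqrt x⌋₊ ⌊x⌋₊, (∑ I ∈ idealsOfNorm K n, w I * idealVonMangoldt I) * tzTest (Real.log x) ε (Real.log n) := by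
        refine Finset.sum_congr rfl fun n hn ↦ ?_
        rw [Finset.mem_Ioc] at hn
        have hn0 : (0 : ℝ) < n := by exact_mod_cast (show 0 < n by omega)
        have h1 : Real.sqrt x < n := by
          have := Nat.lt_of_floor_lt hn.1
          exact_mod_cast this
        have h2 : (n : ℝ) ≤ x := by
          have := Nat.floor_le hx0.le
          have : (n : ℝ) ≤ ⌊x⌋₊ := by exact_mod_cast hn.2
          linarith
        have hlog1 : Real.log x / 2 ≤ Real.log n := by
          have := Real.log_le_log (Real.sqrt_pos.2 hx0) h1.le
          rwa [Real.log_sqrt hx0.le] at this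
        have hlog2 : Real.log n ≤ Real.log x := Real.log_le_log hn0 h2
        rw [tzTest_eq_one hL hε hlog1 hlog2, mul_one]
    _ ≤ ∑ n ∈ Finset.range N, (∑ I ∈ idealsOfNorm K n, w I * idealVonMangoldt I) * tzTest (Real.log x) ε (Real.log n) := by
        refine Finset.sum_le_sum_of_subset_of_nonneg hsub fun n _ _ ↦ ?_
        exact mul_nonneg (vonMangoldtWeighted_nonneg hw n) (tzTest_mem_Icc _ _ _).1

/-- **`ψ_w(√x) ≤ n_K (log 4 + 4) √x`** (through `ψ_K ≤ n_K ψ` and Chebyshev). -/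
theorem psiWeighted_sqrt_le (hw1 : ∀ I, w I ≤ 1) (x : ℝ) :
    (∑ n ∈ Icc 0 ⌊Real.sqrt x⌋₊, ∑ I ∈ idealsOfNorm K n, w I * idealVonMangoldt I) ≤ Module.finrank ℚ K * (Real.log 4 + 4) * Real.sqrt x := by
  refine (psiWeighted_le_chebyshevPsiIdeal hw1 _).trans ((chebyshevPsiIdeal_le_finrank_mul_psi K _).trans ?_)
  rw [mul_assoc]
  exact mul_le_mul_of_nonneg_left (Chebyshev.psi_le_const_mul_self (Real.sqrt_nonneg x)) (Nat.cast_nonneg _)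

/-- **Two-sided unsmoothing for `ψ_w`.**  For `0 ≤ w ≤ 1`, `x e^{−ε} > 1`, `ε > 0`:
`ψ̃_w(g_{x e^{−ε}}) ≤ ψ_w(x) ≤ ψ̃_w(g_x) + n_K (log 4 + 4) √x`. -/
theorem psiWeighted_mem_Icc (hw : ∀ I, 0 ≤ w I) (hw1 : ∀ I, w I ≤ 1) {x ε : ℝ} (hε : 0 < ε)
    (hx : 1 < x * Real.exp (-ε)) :
    (∑' n : ℕ, (∑ I ∈ idealsOfNorm K n, w I * idealVonMangoldt I) * tzTest (Real.log (x * Real.exp (-ε))) ε (Real.log n)) ≤ (∑ n ∈ Icc 0 ⌊x⌋₊, ∑ I ∈ idealsOfNorm K n, w I * idealVonMangoldt I) ∧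
      (∑ n ∈ Icc 0 ⌊x⌋₊, ∑ I ∈ idealsOfNorm K n, w I * idealVonMangoldt I) ≤ (∑' n : ℕ, (∑ I ∈ idealsOfNorm K n, w I * idealVonMangoldt I) * tzTest (Real.log x) ε (Real.log n)) +
        Module.finrank ℚ K * (Real.log 4 + 4) * Real.sqrt x := by
  have hx1 : 1 < x := by
    have : Real.exp (-ε) ≤ 1 := Real.exp_le_one_iff.2 (by linarith)
    have hx0 : 0 < x := by
      by_contra h; rw [not_lt] at h
      have : x * Real.exp (-ε) ≤ 0 := mul_nonpos_of_nonpos_of_nonneg h (Real.exp_pos _).le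
      linarith
    nlinarith
  have h1 := smoothedPsiWeighted_le_psiWeighted (K := K) hw hx hε
  rw [mul_assoc, ← Real.exp_add, neg_add_cancel, Real.exp_zero, mul_one] at h1
  have h2 := psiWeighted_le_smoothedPsiWeighted_add (K := K) hw hx1 hε
  have h3 := psiWeighted_sqrt_le (K := K) hw1 x
  exact ⟨h1, by linarith⟩

end Summit.QuantumAdvantage.QuantumAdvantage.Theorems.DegreeOnePrimesEscape
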